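import Literature.AnabelianGeometry.EtaleTheta.SettingModelTateTwistedProp15iii
import Literature.AnabelianGeometry.EtaleTheta.SettingModelTateInvClauses
import Literature.AnabelianGeometry.AbsoluteAnabelian.GaloisCyclotomeAction
import HarnessLib

/-!
# Inversion automorphisms RE-CENTRED by `Inn(τ)`, `τ ∈ Δ^tp_X` (generic), and the stage-2 («Tate shear») model of [EtTh] §1
# at `(i, j) = (2, 2)`: the `σ₀⁻¹`-displays and the transport of `log(Ü)` along the inversion of record (defect `κ̈(q̈)⁻¹`)
# (proof-only)

S. Mochizuki, *The étale theta function and its Frobenioid-theoretic manifestations*, Publ. RIMS **45** (2009) [EtTh], §1,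
Prop. 1.5 (iii), PRIMS PDF p. 23 (printed 249): «any inversion automorphism ι of Π^tp_X, i.e., an automorphism lying over the
action of “−1” on the underlying elliptic curve … fixes η̈^Θ + log(O^×_K̈), but maps log(Ü) + log(O^×_K̈) to −log(Ü) + log(O^×_K̈)»;
Thm. 1.6 (iii) p. 24 (the transport of classes) [cite: MochizukiEtTh2009, Prop 1.5 (iii) p.23].  abc-iut cell, layer L2, seat
abc-iut-L2-t12 (gen 10); row (T3) «JOINT-INV@(2,2)», file A of two (file B: `SettingModelTateTwistedInvClauses`).  PROOF-ONLY:
no definition, no instance, no `Prop` fact; everything BY NAME over abc-iut-L2-t1's `IsInversionAut` / `ThetaCompanion` /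
`transport` / `IsInversionAut.thetaIso_apply_eq_self`, abc-iut-w5-d249's `inversionχq` (`yCoordχq_inversionχq`: defect exponent
`j − 2i`), abc-iut-L2-d1's `isInversionAut_inversionχq` / `transport_etaDdχq` / `nonempty_thetaCompanion_inversionχq`,
abc-iut-L2-t6's `conj_deckGen_logUdd` / `kumYdd_toKddHat_qddUnit_eq_mk` / `coe_kummerContCocycle_qdd_apply`, this seat's
`conj_deckGen_zClassYddχq_gen`, abc-iut-L2-t8's `inflTheta_conj_toTheta`, and [AbsTopIII]'s `conjContinuousMulEquiv` (`Inn(τ)` as a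
topological automorphism).

GENERIC (`namespace ThetaSetting`, any theta setting `D`):
* `thetaToEll_toTheta_comm_of_aug_eq_one` — images of `Δ^tp_X` commute in `(Π^tp_X)^ell` (root field `ker_toEll`);
* **`IsInversionAut.trans_conj`** — an inversion automorphism `ι` followed by `Inn(τ)`, `τ ∈ Δ^tp_X`, IS an inversion automorphism
  (print's «an automorphism lying over “−1”» is determined only up to such re-centring);
* **`IsInversionAut.transport_trans_conj`** — on `H¹(Π^tp_Ÿ, Δ_Θ)`, transport along `Inn(τ) ∘ ι` = `conj τ` ∘ transport along `ι`,
  for EVERY pair of theta companions (both are the identity on `Δ_Θ`; `Δ_Θ` is central in `(Δ^tp_X)^Θ`).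
STAGE-2 MODEL (`namespace SettingModel`): `isInversionAut_inversionχq_recentred` — `ι′ := Inn(σ₀⁻¹) ∘ ι`, `σ₀ = (a, 1)` the deck
generator, is an inversion automorphism of `modelχq p i j`, with a theta companion; the `σ₀⁻¹`-displays
**`conj_deckGen_inv_logUdd`** (`σ₀⁻¹·log(Ü) = log(Ü)·κ̈(q̈)⁻¹`, `j = 2`) and **`conj_deckGen_inv_zClassYddχq_two_two`**
(`σ₀⁻¹·x′ = x′·log(Ü)²` at `(2, 2)`); and **`transport_inflTheta_logUdd_kummerCoreχq_two_two`** — along the inversion OF RECORD at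
`(2, 2)`, `ι_* infl(log Ü) = infl(log Ü)⁻¹ · infl(κ̈(q̈))⁻¹` for every companion (the defect-free case `j = 2i` is abc-iut-L2-d1's
`transport_inflTheta_logUdd_kummerCoreχq_of`; at `(2, 2)` the defect is the Kummer class of `q̈⁻¹`, so clause (b) of Prop. 1.5
(iii) for `ι` itself would need `κ̈(q̈)` to be a unit class — not decided here; file B shows the re-centred `ι′` has NO defect).
HONEST FRAMING: SEMI-SYNTHETIC model — consistency / non-vacuity evidence for the typed interface ONLY; [EtTh] is refereed and
nothing of it is disputed or asserted; typed ≠ proved; inhabited-at-a-model ≠ proved; no side taken on [IUTchIII] Cor. 3.12.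
-/

noncomputable section

namespace Literature.AnabelianGeometry.EtaleTheta

open Literature.AnabelianGeometry.SemiGraphs Literature.AnabelianGeometry.AbsoluteAnabelian
open scoped commutatorElement

namespace ThetaSetting

variable {p : ℕ} [Fact p.Prime] {D : ThetaSetting p} {ι : D.PiTemp ≃ₜ* D.PiTemp}

/-! ### Generic: an inversion automorphism followed by `Inn(τ)`, `τ ∈ Δ^tp_X`, is an inversion automorphism -/

/-- The images of two elements of `Δ^tp_X` in `(Π^tp_X)^ell` commute («`Δ^ell_X := Δ^ab_X`», p. 12: the kernel of
`Π^tp_X ↠ (Π^tp_X)^ell` is the pull-back of the closure of `[Δ_X, Δ_X]`, root field `ker_toEll`).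
[cite: MochizukiEtTh2009, §1 p.12] -/
theorem thetaToEll_toTheta_comm_of_aug_eq_one {x y : D.PiTemp} (hx : D.aug x = 1) (hy : D.aug y = 1) :
    D.thetaToEll (D.toTheta x) * D.thetaToEll (D.toTheta y) =
      D.thetaToEll (D.toTheta y) * D.thetaToEll (D.toTheta x) := by
  have hmem : ⁅x, y⁆ ∈ (D.thetaToEll.comp D.toTheta).ker := by
    rw [D.ker_toEll, Subgroup.mem_comap, map_commutatorElement]
    exact Subgroup.le_topologicalClosure _ (Subgroup.commutator_mem_commutator
      (CurveTheta.toHat_mem_deltaHat_of_mem_deltaTemp D.toTemperedCurve (b := x) hx)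
      (CurveTheta.toHat_mem_deltaHat_of_mem_deltaTemp D.toTemperedCurve (b := y) hy))
  rw [MonoidHom.mem_ker, commutatorElement_def, map_mul, map_mul, map_mul, map_inv, map_inv,
    MonoidHom.comp_apply, MonoidHom.comp_apply, mul_inv_eq_one, mul_inv_eq_iff_eq_mul] at hmem
  exact hmem

/-- A subgroup that is normal in `Π^tp_X` and preserved by `ι` is preserved by `Inn(τ) ∘ ι`.
[cite: MochizukiEtTh2009, Prop 1.5 (iii) p.23] -/
theorem map_trans_conj_eq_of_map_eq {H : Subgroup D.PiTemp} (hN : H.Normal)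
    (h : H.map ι.toMulEquiv.toMonoidHom = H) (τ : D.PiTemp) :
    H.map (ι.trans (conjContinuousMulEquiv τ)).toMulEquiv.toMonoidHom = H := by
  ext x
  constructor
  · rintro ⟨y, hy, rfl⟩
    change τ * ι y * τ⁻¹ ∈ H
    exact hN.conj_mem _ (h.le ⟨y, hy, rfl⟩) τ
  · intro hx
    refine ⟨ι.symm (τ⁻¹ * x * τ⁻¹⁻¹), ?_, ?_⟩
    · exact (IsInversionAut.map_symm_eq_of_map_eq h).le ⟨_, hN.conj_mem _ hx τ⁻¹, rfl⟩
    · change τ * ι (ι.symm (τ⁻¹ * x * τ⁻¹⁻¹)) * τ⁻¹ = x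
      rw [ι.apply_symm_apply, inv_inv, ← mul_assoc, ← mul_assoc, mul_inv_cancel, one_mul, mul_assoc,
        mul_inv_cancel, mul_one]

/-- **An inversion automorphism followed by an inner automorphism `Inn(τ)`, `τ ∈ Δ^tp_X`, is an inversion
automorphism**: it still lies over `K` and acts by `−1` on `Z` (abelian) and on `(Δ^tp_X)^ell` (the images of
`Δ^tp_X` commute there), and preserves the normal subgroups `Π^tp_{Y_N}`, `Π^tp_{Z_N}`. (Print's inversion
automorphism is only determined up to such re-centring: «an automorphism … lying over the action of “−1”».)
[cite: MochizukiEtTh2009, Prop 1.5 (iii) p.23] -/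
theorem IsInversionAut.trans_conj (hι : D.IsInversionAut ι) {τ : D.PiTemp} (hτ : D.aug τ = 1) :
    D.IsInversionAut (ι.trans (conjContinuousMulEquiv τ)) where
  aug_apply g := by
    rw [ContinuousMulEquiv.trans_apply, conjContinuousMulEquiv_apply, map_mul, map_mul, map_inv, hτ,
      hι.aug_apply, one_mul, inv_one, mul_one]
  toZ_apply g := by
    rw [ContinuousMulEquiv.trans_apply, conjContinuousMulEquiv_apply, map_mul, map_mul, map_inv, hι.toZ_apply,
      mul_inv_cancel_comm]
  ell_apply g hg := by
    have hιg : D.aug (ι g) = 1 := by rw [hι.aug_apply]; exact hg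
    rw [ContinuousMulEquiv.trans_apply, conjContinuousMulEquiv_apply]
    simp only [map_mul, map_inv]
    rw [thetaToEll_toTheta_comm_of_aug_eq_one hτ hιg, mul_inv_cancel_right, hι.ell_apply g hg]
  map_GtpYN N := map_trans_conj_eq_of_map_eq (D.GtpYN_normal N) (hι.map_GtpYN N) τ
  map_GtpZN N := map_trans_conj_eq_of_map_eq (D.GtpZN_normal N) (hι.map_GtpZN N) τ

/-! ### Generic: the transport along `Inn(τ) ∘ ι` is `Inn(τ)` after the transport along `ι` -/

/-- On cocycles, the transport along an inversion automorphism `ι` (any theta companion) is `f ↦ f ∘ ι⁻¹`: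
`ι^Θ = id` on `Δ_Θ` (abc-iut-L2-t1's `IsInversionAut.thetaIso_apply_eq_self`). [cite: MochizukiEtTh2009, Thm 1.6 (iii) p.24] -/
theorem IsInversionAut.coe_transportFun_apply (hι : D.IsInversionAut ι) (cι : ThetaCompanion ι)
    (f : D.GtpYdd → D.DeltaTheta) (y : D.GtpYdd) :
    ((transportFun cι hι.thm16i f y : D.DeltaTheta) : D.GtpTheta) =
      (f ⟨ι.toMulEquiv.symm y.1, symm_mem_GtpYdd hι.thm16i y⟩ : D.GtpTheta) :=
  hι.thetaIso_apply_eq_self cι (f _).2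

/-- The same in `Δ_Θ`. [cite: MochizukiEtTh2009, Thm 1.6 (iii) p.24] -/
theorem IsInversionAut.transportFun_apply (hι : D.IsInversionAut ι) (cι : ThetaCompanion ι)
    (f : D.GtpYdd → D.DeltaTheta) (y : D.GtpYdd) :
    transportFun cι hι.thm16i f y = f ⟨ι.toMulEquiv.symm y.1, symm_mem_GtpYdd hι.thm16i y⟩ :=
  Subtype.ext (hι.coe_transportFun_apply cι f y)

/-- **Transport along the re-centred inversion = `Inn(τ)` ∘ transport along `ι`** on `H¹(Π^tp_Ÿ, Δ_Θ)`, for EVERY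
theta companion of `ι` and EVERY theta companion of `Inn(τ) ∘ ι` (`τ ∈ Δ^tp_X`): both companions are the identity on
`Δ_Θ`, and `(τ)^Θ` centralises `Δ_Θ` (`Δ_Θ` is central in `(Δ^tp_X)^Θ`, root field `ker_thetaToEll_central`).
[cite: MochizukiEtTh2009, Thm 1.6 (iii) p.24] -/
theorem IsInversionAut.transport_trans_conj (hι : D.IsInversionAut ι) (cι : ThetaCompanion ι) {τ : D.PiTemp}
    (hτ : D.aug τ = 1) (c' : ThetaCompanion (ι.trans (conjContinuousMulEquiv τ))) (hC : D.Compat)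
    (x : D.H1 D.GtpYdd) :
    haveI := hC.GtpYdd_normal
    transport c' (hι.trans_conj hτ).thm16i x = ContH1.conj D.toTheta D.DeltaTheta τ (transport cι hι.thm16i x) := by
  haveI := hC.GtpYdd_normal
  induction x using QuotientGroup.induction_on with
  | H f =>
    change ContH1.mk _ _ = ContH1.mk _ _
    refine ContH1.mk_congr _ (funext fun y => Subtype.ext ?_) _ _
    change ((transportFun c' (hι.trans_conj hτ).thm16i f.1 y : D.DeltaTheta) : D.GtpTheta) =
      ((MulAut.conjNormal (D.toTheta τ)
        (transportFun cι hι.thm16i f.1 (MulAut.conjNormal τ⁻¹ y)) : D.DeltaTheta) : D.GtpTheta)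
    rw [(hι.trans_conj hτ).coe_transportFun_apply c', MulAut.conjNormal_apply, hι.coe_transportFun_apply cι,
      ← D.ker_thetaToEll_central _ (f.1 _).2 (D.toTheta τ) ⟨τ, hτ, rfl⟩, mul_inv_cancel_right]
    refine congrArg (fun z : D.GtpYdd => ((f.1 z : D.DeltaTheta) : D.GtpTheta)) (Subtype.ext ?_)
    change ι.symm ((conjContinuousMulEquiv τ).symm (y : D.PiTemp)) = ι.symm (τ⁻¹ * (y : D.PiTemp) * τ⁻¹⁻¹)
    rw [inv_inv]
    rfl

end ThetaSetting

/-! ## The stage-2 model: the re-centred inversion `Inn(σ₀⁻¹) ∘ ι`, `σ₀ = (a, 1)` the deck generator -/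

namespace SettingModel

open Literature.AnabelianGeometry.SemiGraphs

variable (p : ℕ) [Fact p.Prime] (i j : ℤ)

/-- `(γ, 1)⁻¹ ∈ Δ^tp_X`: its Galois coordinate is trivial. [cite: MochizukiEtTh2009, §1 p.17] -/
theorem aug_inl_inv (hj : Even j) (γ : Gfp) :
    (ThetaSetting.modelχq p i j hj).aug (SemidirectProduct.inl γ : PiTpχq p i j)⁻¹ = 1 := by
  rw [map_inv, inv_eq_one]
  rfl

/-- **The stage-2 inversion re-centred by `Inn(τ)`, `τ ∈ Δ^tp_X`, is an inversion automorphism** (Prop. 1.5 (iii)) of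
the stage-2 model. [cite: MochizukiEtTh2009, Prop 1.5 (iii) p.23] -/
theorem isInversionAut_inversionχq_trans_conj (hj : Even j) {τ : PiTpχq p i j}
    (hτ : (ThetaSetting.modelχq p i j hj).aug τ = 1) :
    (ThetaSetting.modelχq p i j hj).IsInversionAut ((inversionχq p i j).trans (conjContinuousMulEquiv τ)) :=
  (isInversionAut_inversionχq p i j hj).trans_conj hτ

/-- In particular **`ι′ := Inn(σ₀⁻¹) ∘ ι`**, `σ₀ = (a, 1)` the deck generator, is an inversion automorphism of the
stage-2 model. [cite: MochizukiEtTh2009, Prop 1.5 (iii) p.23] -/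
theorem isInversionAut_inversionχq_recentred (hj : Even j) :
    (ThetaSetting.modelχq p i j hj).IsInversionAut ((inversionχq p i j).trans
      (conjContinuousMulEquiv (SemidirectProduct.inl (gfpOf (FreeGroup.of 0)) : PiTpχq p i j)⁻¹)) :=
  isInversionAut_inversionχq_trans_conj p i j hj (aug_inl_inv p i j hj _)

/-- A theta companion of `ι′ = Inn(σ₀⁻¹) ∘ ι` exists (abc-iut's `thetaCompanionOfAut`). [cite: MochizukiEtTh2009, Thm 1.6 (ii) p.24] -/
theorem nonempty_thetaCompanion_inversionχq_recentred (hj : Even j) :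
    Nonempty (ThetaSetting.ThetaCompanion (Dα := ThetaSetting.modelχq p i j hj) (Dβ := ThetaSetting.modelχq p i j hj)
      ((inversionχq p i j).trans
        (conjContinuousMulEquiv (SemidirectProduct.inl (gfpOf (FreeGroup.of 0)) : PiTpχq p i j)⁻¹))) :=
  ⟨(ThetaSetting.modelχq p i j hj).thetaCompanionOfAut _ (isInversionAut_inversionχq_recentred p i j hj).map_deltaTemp
    (hasThetaTopology_modelχq p i j hj).isQuotientMap_toTheta⟩

/-! ### `σ₀⁻¹`-displays on `H¹((Π^tp_Ÿ)^Θ, Δ_Θ)`: `σ₀⁻¹·log(Ü) = log(Ü)·κ̈(q̈)⁻¹`, `σ₀⁻¹·x′ = x′·log(Ü)²` -/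

/-- `κ̈(q̈)` is fixed by the conjugation action of `Δ^tp_X` (the core's unit classes move through `G_K`,
`conj_kumYdd_toKddHat`). [cite: MochizukiEtTh2009, Prop 1.5 (iii) p.23] -/
theorem conj_kumYdd_qddUnit_of_aug_eq_one (hj : Even j) (hC : (ThetaSetting.modelχq p i j hj).Compat)
    {τ : PiTpχq p i j} (hτ : (ThetaSetting.modelχq p i j hj).aug τ = 1) :
    haveI := hC.GtpYddTheta_normal
    ContH1.conj (MonoidHom.id (ThetaSetting.modelχq p i j hj).GtpTheta) (ThetaSetting.modelχq p i j hj).DeltaTheta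
        ((ThetaSetting.modelχq p i j hj).toTheta τ)
        ((kummerCoreχq p i j hj).toKummerData.kumYdd
          ((kummerCoreχq p i j hj).toKummerData.toKddHat (ThetaSetting.modelχq p i j hj).qddUnit)) =
      (kummerCoreχq p i j hj).toKummerData.kumYdd
        ((kummerCoreχq p i j hj).toKummerData.toKddHat (ThetaSetting.modelχq p i j hj).qddUnit) :=
  (kummerCoreχq p i j hj).conj_kumYdd_toKddHat hC τ _ _ (by rw [hτ, one_smul])

/-- **`σ₀⁻¹·log(Ü) = log(Ü)·κ̈(q̈)⁻¹`** (`j = 2`, any `i`; from abc-iut-L2-t6's `conj_deckGen_logUdd`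
`σ₀·log(Ü) = log(Ü)·κ̈(q̈)·κ̈(1)`). [cite: MochizukiEtTh2009, Prop 1.5 (iii) p.23] -/
theorem conj_deckGen_inv_logUdd (hC : (ThetaSetting.modelχq p i 2 even_two).Compat) :
    haveI := hC.GtpYddTheta_normal
    ContH1.conj (MonoidHom.id (ThetaSetting.modelχq p i 2 even_two).GtpTheta) (ThetaSetting.modelχq p i 2 even_two).DeltaTheta
        ((ThetaSetting.modelχq p i 2 even_two).toTheta (SemidirectProduct.inl (gfpOf (FreeGroup.of 0)) : PiTpχq p i 2)⁻¹)
        (kummerCoreχq p i 2 even_two).logUdd =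
      (kummerCoreχq p i 2 even_two).logUdd *
        ((kummerCoreχq p i 2 even_two).toKummerData.kumYdd
          ((kummerCoreχq p i 2 even_two).toKummerData.toKddHat (ThetaSetting.modelχq p i 2 even_two).qddUnit))⁻¹ := by
  haveI := hC.GtpYddTheta_normal
  have h := conj_deckGen_logUdd p i hC
  rw [map_one, map_one, mul_one] at h
  have hQ := conj_kumYdd_qddUnit_of_aug_eq_one p i 2 even_two hC (aug_inl_inv p i 2 even_two (gfpOf (FreeGroup.of 0)))
  rw [map_inv] at hQ ⊢
  rw [eq_mul_inv_iff_mul_eq]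
  calc _ = ContH1.conj (MonoidHom.id (ThetaSetting.modelχq p i 2 even_two).GtpTheta)
        (ThetaSetting.modelχq p i 2 even_two).DeltaTheta
        ((ThetaSetting.modelχq p i 2 even_two).toTheta (SemidirectProduct.inl (gfpOf (FreeGroup.of 0)) : PiTpχq p i 2))⁻¹
        ((kummerCoreχq p i 2 even_two).logUdd *
          (kummerCoreχq p i 2 even_two).toKummerData.kumYdd
            ((kummerCoreχq p i 2 even_two).toKummerData.toKddHat (ThetaSetting.modelχq p i 2 even_two).qddUnit)) := by
        rw [map_mul, hQ]
    _ = _ := by rw [← h, ContH1.conj_inv_conj_apply]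


/-- Commutative-group bookkeeping for the `σ₀⁻¹`-display of the `z`-class. [folklore] -/
private theorem inv_display_algebra {H : Type*} [CommGroup H] (x L Q : H) :
    x * L ^ (-(2 : ℤ)) * Q ^ (-(2 : ℤ)) * (L * Q) ^ (2 : ℤ) = x := by
  apply Additive.ofMul.injective
  simp only [ofMul_mul, ofMul_zpow]
  abel

/-- **`σ₀⁻¹·x′ = x′·log(Ü)²`** at `(i, j) = (2, 2)` for the `z`-class `x′ = zClassYddχq` (from this seat's
`conj_deckGen_zClassYddχq_gen`: `σ₀·x′ = x′·log(Ü)^{−2}·κ̈(q̈)^{−2}`, and `σ₀·log(Ü) = log(Ü)·κ̈(q̈)`).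
[cite: MochizukiEtTh2009, Prop 1.5 (iii) p.23] -/
theorem conj_deckGen_inv_zClassYddχq_two_two (hC : (ThetaSetting.modelχq p 2 2 even_two).Compat) :
    haveI := hC.GtpYddTheta_normal
    ContH1.conj (MonoidHom.id (ThetaSetting.modelχq p 2 2 even_two).GtpTheta) (ThetaSetting.modelχq p 2 2 even_two).DeltaTheta
        ((ThetaSetting.modelχq p 2 2 even_two).toTheta (SemidirectProduct.inl (gfpOf (FreeGroup.of 0)) : PiTpχq p 2 2)⁻¹)
        (zClassYddχq p 2 2 even_two) =
      zClassYddχq p 2 2 even_two * (kummerCoreχq p 2 2 even_two).logUdd ^ (2 : ℤ) := by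
  haveI := hC.GtpYddTheta_normal
  have hx := conj_deckGen_zClassYddχq_gen p 2 2 even_two hC
  have hL := conj_deckGen_logUdd p 2 hC
  rw [map_one, map_one, mul_one] at hL
  rw [map_inv]
  apply (ContH1.conj_bijective ((ThetaSetting.modelχq p 2 2 even_two).toTheta
    (SemidirectProduct.inl (gfpOf (FreeGroup.of 0)) : PiTpχq p 2 2))).1
  rw [ContH1.conj_conj_inv_apply, map_mul, map_zpow, hx, hL]
  exact (inv_display_algebra _ _ _).symm

/-! ### The transport of `log(Ü)` along the stage-2 inversion at `(i, j) = (2, 2)`: defect `κ̈(q̈)⁻¹` -/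

/-- The kit's `log(Ü)`-cocycle, evaluated: `c^{ŷ(h)/2}`. [cite: MochizukiEtTh2009, Prop 1.5 p.23] -/
theorem coe_logUddFun_yCoordKitχq (hj : Even j)
    (h : ↥((ThetaSetting.modelχq p i j hj).GtpYdd.map (ThetaSetting.modelχq p i j hj).toTheta)) :
    (((yCoordKitχq p i j hj).logUddFun h : (ThetaSetting.modelχq p i j hj).DeltaTheta) :
        (ThetaSetting.modelχq p i j hj).GtpTheta) =
      cThetaχq p i j (half ⟨yThetaχq p i j (h : (ThetaSetting.modelχq p i j hj).GtpTheta),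
        (yCoordKitχq p i j hj).y_even h h.2⟩) :=
  rfl

/-- On cocycles at `(i, j) = (2, 2)`: `ŷ(ι⁻¹ g)/2 + κ_p(g) + ŷ(g)/2 = 0` (`ŷ(ι g) = −ŷ(g) − 2κ_p(g)`: the defect exponent of
abc-iut-w5-d249's `yCoordχq_inversionχq` is `j − 2i = −2`). [cite: MochizukiEtTh2009, Prop 1.5 (iii) p.23] -/
theorem half_yThetaχq_inversionχq_symm_mul_two_two (g : PiTpχq p 2 2)
    (h₁ : yThetaχq p 2 2 ((ThetaSetting.modelχq p 2 2 even_two).toTheta ((inversionχq p 2 2).toMulEquiv.symm g)) ∈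
      sqHom.range)
    (h₃ : yThetaχq p 2 2 ((ThetaSetting.modelχq p 2 2 even_two).toTheta g) ∈ sqHom.range) :
    half ⟨_, h₁⟩ *
        (kappaP p (CurveTheta.augTheta (curveχq p 2 2) ((ThetaSetting.modelχq p 2 2 even_two).toTheta g)) * half ⟨_, h₃⟩) =
      1 := by
  apply sqHom_injective
  rw [map_mul, map_mul, map_one, sqHom_apply, sqHom_apply, sqHom_apply, half_sq, half_sq]
  change yThetaχq p 2 2 (CurveTheta.toTheta (curveχq p 2 2) ((inversionχq p 2 2).symm g)) *
      (kappaP p ((curveχq p 2 2).aug g) ^ 2 * yThetaχq p 2 2 (CurveTheta.toTheta (curveχq p 2 2) g)) = 1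
  rw [inversionχq_symm_apply, yThetaχq_toTheta, yThetaχq_toTheta, yCoordχq_inversionχq, invDefect_tatePairHom]
  have h2 : (-2 : ℤ) + -2 + 2 = -2 := by norm_num
  rw [h2]
  change (yCoordχq p 2 2 g)⁻¹ * kappaP p g.right ^ (-2 : ℤ) * (kappaP p g.right ^ 2 * yCoordχq p 2 2 g) = 1
  group

/-- The same in `Δ_Θ`, with the middle term the Kummer COCYCLE of `q̈` (abc-iut-L2-t6's `coe_kummerContCocycle_qdd_apply`):
`log(Ü)(ι⁻¹ x) · κ̈(q̈)(x) · log(Ü)(x) = 1` pointwise on `Π^tp_Ÿ`. [cite: MochizukiEtTh2009, Prop 1.5 (iii) p.23] -/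
theorem logUddFun_inversionχq_symm_mul_two_two (x : ↥(ThetaSetting.modelχq p 2 2 even_two).GtpYdd) :
    letI := (ThetaSetting.modelχq p 2 2 even_two).unitsAction (kummerCoreχq p 2 2 even_two).augTheta
    (yCoordKitχq p 2 2 even_two).logUddFun
        ⟨(ThetaSetting.modelχq p 2 2 even_two).toTheta ((inversionχq p 2 2).toMulEquiv.symm (x : PiTpχq p 2 2)),
          ⟨_, ThetaSetting.symm_mem_GtpYdd (isInversionAut_inversionχq p 2 2 even_two).thm16i x, rfl⟩⟩ *
      (((kummerCoreχq p 2 2 even_two).coeff.kummerContCocycle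
          ((ThetaSetting.modelχq p 2 2 even_two).GtpYdd.map (ThetaSetting.modelχq p 2 2 even_two).toTheta)
          ((pRoots p).cast (pUnit_eq_toInvYdd_qddUnit p 2 2 even_two))
          ((kummerCoreχq p 2 2 even_two).toInvYdd (ThetaSetting.modelχq p 2 2 even_two).qddUnit).2
          (fun _ => (kummerCoreχq p 2 2 even_two).isOpen_stabilizer' _)).1
          ⟨(ThetaSetting.modelχq p 2 2 even_two).toTheta (x : PiTpχq p 2 2), ⟨x.1, x.2, rfl⟩⟩ *
        (yCoordKitχq p 2 2 even_two).logUddFun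
          ⟨(ThetaSetting.modelχq p 2 2 even_two).toTheta (x : PiTpχq p 2 2), ⟨x.1, x.2, rfl⟩⟩) = 1 := by
  letI := (ThetaSetting.modelχq p 2 2 even_two).unitsAction (kummerCoreχq p 2 2 even_two).augTheta
  apply Subtype.ext
  rw [Subgroup.coe_mul, Subgroup.coe_mul, Subgroup.coe_one, coe_kummerContCocycle_qdd_apply, coe_logUddFun_yCoordKitχq,
    coe_logUddFun_yCoordKitχq, ← map_mul (cThetaχq p 2 2), ← map_mul (cThetaχq p 2 2),
    half_yThetaχq_inversionχq_symm_mul_two_two, map_one]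

/-- **`ι_* infl(log Ü) = infl(log Ü)⁻¹ · infl(κ̈(q̈))⁻¹` on `Π^tp_Ÿ` at `modelχq p 2 2`**, for EVERY theta companion of the
stage-2 inversion `ι` (the defect-free case `j = 2i` is abc-iut-L2-d1's `transport_inflTheta_logUdd_kummerCoreχq_of`; here
`j − 2i = −2` and the defect is the Kummer class of `q̈⁻¹`). [cite: MochizukiEtTh2009, Prop 1.5 (iii) p.23] -/
theorem transport_inflTheta_logUdd_kummerCoreχq_two_two
    (cι : ThetaSetting.ThetaCompanion (Dα := ThetaSetting.modelχq p 2 2 even_two)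
      (Dβ := ThetaSetting.modelχq p 2 2 even_two) (inversionχq p 2 2)) :
    ThetaSetting.transport cι (isInversionAut_inversionχq p 2 2 even_two).thm16i
        ((ThetaSetting.modelχq p 2 2 even_two).inflTheta (ThetaSetting.modelχq p 2 2 even_two).GtpYdd
          (kummerCoreχq p 2 2 even_two).logUdd) =
      ((ThetaSetting.modelχq p 2 2 even_two).inflTheta (ThetaSetting.modelχq p 2 2 even_two).GtpYdd
          (kummerCoreχq p 2 2 even_two).logUdd)⁻¹ *
        ((ThetaSetting.modelχq p 2 2 even_two).inflTheta (ThetaSetting.modelχq p 2 2 even_two).GtpYdd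
          ((kummerCoreχq p 2 2 even_two).toKummerData.kumYdd
            ((kummerCoreχq p 2 2 even_two).toKummerData.toKddHat (ThetaSetting.modelχq p 2 2 even_two).qddUnit)))⁻¹ := by
  letI := (ThetaSetting.modelχq p 2 2 even_two).unitsAction (kummerCoreχq p 2 2 even_two).augTheta
  rw [kumYdd_toKddHat_qddUnit_eq_mk, ← mul_inv_rev, eq_inv_iff_mul_eq_one]
  change ContH1.mk _ _ * (ContH1.mk _ _ * ContH1.mk _ _) = 1
  rw [ContH1.mk_mul_mk, ContH1.mk_mul_mk, ← ContH1.mk_one]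
  refine ContH1.mk_congr _ (funext fun x => ?_) _ _
  rw [Pi.mul_apply, Pi.mul_apply, Pi.one_apply, (isInversionAut_inversionχq p 2 2 even_two).transportFun_apply cι]
  exact logUddFun_inversionχq_symm_mul_two_two p x

end SettingModel

end Literature.AnabelianGeometry.EtaleTheta

end
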